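import Summits.RiemannHypothesis.RiemannHypothesis.Theorems.EtaLeadingQuarterSecondMomentEngineShift
import HarnessLib

/-!
# The sharp eta vector at the zeros — engine III: the truncation error with NO resonance condition
(route EtaLeadingQuarter, item `EtaLeadingSecondMoment`, stmt-RiemannHypothesis-21791)

RH-free. For `s = 1/2 + it`, an integer `X ≥ 16`, `y = t/(2πX) ∈ [1/2, X]` and
`Q_X(s) = ζ(s) − ∑_{n≤X} n^{−s} + X^{1−s}/(1−s) − afeCoeff(s) ∑_{ν≤[y]} ν^{s−1}`:
`‖Q_X(s)‖ ≤ (110 + 6 log(y+2))/√X + 64/√y` (`norm_Q_le_uniform`) — Titchmarsh's Theorem 4.13 at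
`σ = 1/2` in the range `x ≥ √(t/2π)`, uniform in the position of `y` relative to the integers
(`64/√y = O(√(X/t))` is the book's `O(t^{1/2−σ} y^{σ−1})`). Off resonance this is part I; at a
resonance the pieces of part II are added up. Nothing here bears on the truth of RH.
-/

noncomputable section

open Real Finset Complex

set_option linter.dupNamespace false  -- the mandated namespace repeats `RiemannHypothesis`

namespace Summit.RiemannHypothesis.RiemannHypothesis.Theorems.EtaLeadingQuarter.Engine

open Literature.NumberTheory.LFunctions Literature.NumberTheory.LFunctions.VdC
  Literature.NumberTheory.LFunctions.AFE

/-! ## The uniform bound -/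

/-- **The truncation error with no resonance condition.** For `s = 1/2 + it`, `t > 0`, an
integer `X ≥ 16` and `y = t/(2πX)` with `1/2 ≤ y ≤ X`:
`‖ζ(s) − ∑_{n≤X} n^{−s} + X^{1−s}/(1−s) − afeCoeff(s) ∑_{ν≤[y]} ν^{s−1}‖ ≤ (110 + 6 log(y+2))/√X + 64/√y`
(Titchmarsh Theorem 4.13 at `σ = 1/2` in the unbalanced range `x ≥ √(t/2π)`, uniform in the
position of `y` relative to the integers). [folklore] -/
theorem norm_Q_le_uniform {t : ℝ} (ht : 0 < t) {X : ℕ} (hX : 16 ≤ X)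
    (hy1 : 1 / 2 ≤ t / (2 * π * X)) (hyX : t / (2 * π * X) ≤ X) (s : ℂ) (hs : s = 1 / 2 + t * I) :
    ‖riemannZeta s - ∑ n ∈ Finset.Icc 1 X, (n : ℂ) ^ (-s) + (X : ℂ) ^ (1 - s) / (1 - s)
        - afeCoeff s * ∑ n ∈ Finset.Icc 1 ⌊t / (2 * π * X)⌋₊, (n : ℂ) ^ (s - 1)‖ ≤
      (110 + 6 * Real.log (t / (2 * π * X) + 2)) / Real.sqrt X +
        64 / Real.sqrt (t / (2 * π * X)) := by
  set y : ℝ := t / (2 * π * X) with hydef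
  have hX1 : 1 ≤ X := by omega
  have hX0 : (0 : ℝ) < X := by exact_mod_cast (show 0 < X by omega)
  have hX16 : (16 : ℝ) ≤ X := by exact_mod_cast hX
  have hy0 : 0 < y := by linarith
  have hsX : 0 < Real.sqrt X := Real.sqrt_pos.2 hX0
  have hsy : 0 < Real.sqrt y := Real.sqrt_pos.2 hy0
  have hlog0 : 0 ≤ Real.log (y + 2) := Real.log_nonneg (by linarith)
  have hRHS0 : 0 ≤ 64 / Real.sqrt y := by positivity
  have weak : ∀ c : ℝ, c ≤ 110 + 6 * Real.log (y + 2) →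
      c / Real.sqrt X ≤ (110 + 6 * Real.log (y + 2)) / Real.sqrt X + 64 / Real.sqrt y := by
    intro c hc
    have := div_le_div_of_nonneg_right hc hsX.le
    linarith
  -- Case B: below the first stationary point
  rcases le_or_gt y (7 / 8) with hB | hB
  · refine (norm_Q_le_of_low ht hX1 (δ := 1 / 8) (by norm_num) (by norm_num) (by linarith) s hs).trans
      (weak _ ?_)
    norm_num; linarith
  -- Case A: stationary, off resonance
  by_cases hA : 1 ≤ y ∧ 1 / 8 ≤ Int.fract y ∧ Int.fract y ≤ 7 / 8
  · refine (norm_Q_le_of_gap ht hX1 (δ := 1 / 8) (by norm_num) hA.1 hA.2.1 (by linarith [hA.2.2])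
      s hs).trans (weak _ ?_)
    norm_num; linarith
  -- Case C: a resonance `|y - j| < 1/8`, `j ≥ 1`
  have hC : y < 1 ∨ Int.fract y < 1 / 8 ∨ 7 / 8 < Int.fract y := by
    rcases lt_or_ge y 1 with h1 | h1
    · exact Or.inl h1
    rcases lt_or_ge (Int.fract y) (1 / 8) with h2 | h2
    · exact Or.inr (Or.inl h2)
    rcases le_or_gt (Int.fract y) (7 / 8) with h3 | h3
    · exact absurd ⟨h1, h2, h3⟩ hA
    · exact Or.inr (Or.inr h3)
  obtain ⟨j, hj1, hjy⟩ := exists_nat_near hB hC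
  have hj1R : (1 : ℝ) ≤ j := by exact_mod_cast hj1
  obtain ⟨hjy1, hjy2⟩ := abs_lt.1 hjy
  -- the shifted length `a = t/(2π(j+1/2))`, `X' = [a]`
  have htXy : t = 2 * π * X * y := by rw [hydef]; field_simp
  set a : ℝ := (X : ℝ) * y / (j + 1 / 2) with hadef
  have hj0 : (0 : ℝ) < j + 1 / 2 := by linarith
  have ha0 : 0 < a := by rw [hadef]; positivity
  have hta : t = 2 * π * a * ((j : ℝ) + 1 / 2) := by rw [hadef, htXy]; field_simp
  set X' : ℕ := ⌊a⌋₊ with hX'def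
  have hX'a : (X' : ℝ) ≤ a := Nat.floor_le ha0.le
  have haX' : a < X' + 1 := Nat.lt_floor_add_one a
  obtain ⟨haX, halo, hX'half, hX'X, hX'1, -⟩ := shift_shape hX16 hB hjy1 hjy2 hadef hX'a haX'
  have hX'0 : (0 : ℝ) < X' := by exact_mod_cast (show 0 < X' by omega)
  have hsX' : 0 < Real.sqrt X' := Real.sqrt_pos.2 hX'0
  -- (T1) the gap AFE at `(X', a)` with dual length `j + 1/2`
  have hfr : Int.fract ((j : ℝ) + 1 / 2) = 1 / 2 := by
    rw [Int.fract_natCast_add]; exact Int.fract_eq_self.2 ⟨by norm_num, by norm_num⟩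
  have hT1 := approxFunctionalEq_half_of_gap (X := X') (a := a) (y := (j : ℝ) + 1 / 2)
    (δ := 1 / 2) ha0 (by linarith) (by norm_num) hta (by rw [hfr]) (by rw [hfr]; norm_num)
    hX'a haX'.le hX'1 s hs
  have hfl : ⌊(j : ℝ) + 1 / 2⌋₊ = j := by
    rw [add_comm, Nat.floor_add_natCast (by norm_num : (0 : ℝ) ≤ 1 / 2),
      Nat.floor_eq_zero.2 (by norm_num : (1 / 2 : ℝ) < 1), zero_add]
  rw [hfl] at hT1
  -- (T2) the block `∑_{X'<n≤X} n^{-s}`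
  have hT2 : ‖∑ n ∈ Finset.Ioc X' X, (n : ℂ) ^ (-s)‖ ≤ 68 / Real.sqrt X + 62 / Real.sqrt y := by
    rw [hs]
    exact norm_block_shift_le ht hX16 htXy hB hyX hjy1 hjy2 hadef hX'a haX'
  -- (T3) the main term
  have hT3 : ‖(X : ℂ) ^ (1 - s) / (1 - s)‖ ≤ 1 / Real.sqrt X := by
    refine (norm_cpow_one_sub_div_le ht hX1 s hs).trans ?_
    rw [div_le_div_iff₀ ht hsX, Real.mul_self_sqrt hX0.le, one_mul, htXy]
    have h1 : (1 : ℝ) ≤ 2 * π * y := by nlinarith [Real.pi_gt_three]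
    calc (X : ℝ) = X * 1 := by ring
      _ ≤ X * (2 * π * y) := by gcongr
      _ = 2 * π * X * y := by ring
  -- the decomposition of `Q_X`
  set C : ℂ := afeCoeff s with hCdef
  set D : ℕ → ℂ := fun m ↦ ∑ n ∈ Finset.Icc 1 m, (n : ℂ) ^ (s - 1) with hDdef
  have hsplit : ∑ n ∈ Finset.Icc 1 X, (n : ℂ) ^ (-s) =
      ∑ n ∈ Finset.Icc 1 X', (n : ℂ) ^ (-s) + ∑ n ∈ Finset.Ioc X' X, (n : ℂ) ^ (-s) := by
    rw [show Finset.Icc 1 X = Finset.Ioc 0 X from Finset.Icc_add_one_left_eq_Ioc 0 X,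
      show Finset.Icc 1 X' = Finset.Ioc 0 X' from Finset.Icc_add_one_left_eq_Ioc 0 X',
      Finset.sum_Ioc_consecutive _ (Nat.zero_le X') hX'X]
  have hdec : riemannZeta s - ∑ n ∈ Finset.Icc 1 X, (n : ℂ) ^ (-s) + (X : ℂ) ^ (1 - s) / (1 - s)
        - C * D ⌊y⌋₊ =
      (riemannZeta s - ∑ n ∈ Finset.Icc 1 X', (n : ℂ) ^ (-s) - C * D j)
        - ∑ n ∈ Finset.Ioc X' X, (n : ℂ) ^ (-s) + (X : ℂ) ^ (1 - s) / (1 - s) + C * (D j - D ⌊y⌋₊) := by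
    rw [hsplit]; ring
  -- (T4) the dual adjustment `C (D j − D [y])`
  have hT4 : ‖C * (D j - D ⌊y⌋₊)‖ ≤ 1 / Real.sqrt y := norm_dual_adjust_le hy0 hjy1 hjy2 s hs
  have hsqX' : 1 / Real.sqrt X' ≤ Real.sqrt 2 / Real.sqrt X :=
    one_div_sqrt_le_sqrt_two_div hX'0 hX0 hX'half
  have hsqa : 1 / Real.sqrt a ≤ Real.sqrt 2 / Real.sqrt X :=
    (div_le_div_of_nonneg_left zero_le_one hsX' (Real.sqrt_le_sqrt hX'a)).trans hsqX'
  have hT1' : ‖riemannZeta s - ∑ n ∈ Finset.Icc 1 X', (n : ℂ) ^ (-s) - C * D j‖ ≤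
      (33 + 6 * Real.log (y + 2)) / Real.sqrt X := by
    refine hT1.trans ?_
    have hpX' : (X' : ℝ) ^ (-(1 / 2 : ℝ)) = 1 / Real.sqrt X' := by
      rw [Real.rpow_neg hX'0.le, ← Real.sqrt_eq_rpow, one_div]
    have hpa : a ^ (-(1 / 2 : ℝ)) = 1 / Real.sqrt a := by
      rw [Real.rpow_neg ha0.le, ← Real.sqrt_eq_rpow, one_div]
    rw [hpX', hpa]
    have hlogj : Real.log ((j : ℝ) + 1 / 2 + 2) ≤ 7 / 5 + Real.log (y + 2) := by
      have h3 : Real.log ((j : ℝ) + 1 / 2 + 2) ≤ Real.log (3 * (y + 2)) :=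
        Real.log_le_log (by positivity) (by linarith)
      rw [Real.log_mul (by norm_num) (by linarith)] at h3
      linarith [log_three_le]
    have hlogj0 : 0 ≤ Real.log ((j : ℝ) + 1 / 2 + 2) := Real.log_nonneg (by linarith)
    exact afe_shift_numeric hsX hsqX' hsqa hlogj0 hlogj hlog0
  have hfin : ‖riemannZeta s - ∑ n ∈ Finset.Icc 1 X, (n : ℂ) ^ (-s) + (X : ℂ) ^ (1 - s) / (1 - s)
        - C * D ⌊y⌋₊‖ ≤ (33 + 6 * Real.log (y + 2)) / Real.sqrt X + (68 / Real.sqrt X + 62 / Real.sqrt y) +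
        1 / Real.sqrt X + 1 / Real.sqrt y := by
    rw [hdec]
    refine (norm_add_le _ _).trans (add_le_add ((norm_add_le _ _).trans (add_le_add
      ((norm_sub_le _ _).trans (add_le_add hT1' hT2)) hT3)) hT4)
  refine hfin.trans ?_
  have e4 : (33 + 6 * Real.log (y + 2)) / Real.sqrt X + (68 / Real.sqrt X + 62 / Real.sqrt y) +
        1 / Real.sqrt X + 1 / Real.sqrt y =
      (102 + 6 * Real.log (y + 2)) / Real.sqrt X + 63 / Real.sqrt y := by
    field_simp; ring
  rw [e4]
  have h5 : (102 + 6 * Real.log (y + 2)) / Real.sqrt X ≤ (110 + 6 * Real.log (y + 2)) / Real.sqrt X :=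
    div_le_div_of_nonneg_right (by linarith) hsX.le
  have h6 : 63 / Real.sqrt y ≤ 64 / Real.sqrt y := div_le_div_of_nonneg_right (by norm_num) hsy.le
  exact add_le_add h5 h6

end Summit.RiemannHypothesis.RiemannHypothesis.Theorems.EtaLeadingQuarter.Engine

end
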